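import Mathlib
import Summits.Ventures.PercRepro2.TB14Fold

/-!
# The three classes of `b` in the folded form of typed BHK 1.4 — the core class vanishes
(blind cell PercRepro2, mine-c g14, 2026-08-25; MINE-C.md §23.6–§23.7; candidate row 2′TB-X)

Folded vocabulary of `TB14Fold`: at the profile «`F` free, `z` pinned» the first copy is `y`, the second
`w = flipOn F y`; the (TB14) slack is `pairCount F z foldBO` with
`foldBO y w = 1_Q(y)·1_Q(w)·1_{b∈C₁}(y)·(1_{o∈C₂}(y) − 1_{o∈C₂}(w))` (`pairCount_fold`).
Split the summand by the STATUS OF `b` in the second copy — `b ∈ C₁(w)` (the CORE class: `b` joined to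
`a₁` in both copies), `b ∉ C₁(w)` and `b ∈ C₂(w)` (the CROSSING class: `b` joined to `a₁` in the first
copy and to `a₂` in the second), or `b ∉ C₁(w) ∪ C₂(w)` (the FREE class):
* `foldBO_eq_classes`: `foldBO = coreBO + crossClassBO + freeClassBO` pointwise (a ring identity);
* **`pairCount_core_eq_zero`**: the CORE class contributes nothing — its summand is antisymmetric under
  the exchange of the two copies (`pairCount_swap`);
* **`tb14_slack_eq_classes`**: `N(QAB, Q) − N(QB, QA) = pairCount F z crossClassBO + pairCount F z freeClassBO`,
  so (TB14) at the profile ⟺ the crossing-class count plus the free-class count is ≤ 0 … in the folded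
  sign convention: the slack `pairCount sameBO − pairCount crossBO` is the sum of the two class counts.
The census of record (MINE-C.md §23.6: `n ≤ 7`, `m ≤ 13`, 533,843 class fibres, 0 negative) says each of
the two class counts is ≤ 0 on its own (each class inequality is a CANDIDATE, not proved here); nothing
finer than the status of `b` is signed. Nothing here proves (TB14); it localises its content to `b`'s
status. Axioms: standard.
-/

namespace Summit.Ventures.PercRepro2

namespace TB14Fold

open CovForm A3InactiveTyped

section Classes

variable {V : Type} {E : Type} [Fintype E] [DecidableEq E] {R : Type*} [Field R]

/-- The CORE-class summand: the folded summand weighted by `1_{b ∈ C₁}(w)` (`b` joined to `a₁` in the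
second copy too, i.e. `b ∈ S ∩ S′` in one-colouring language). -/
noncomputable def coreBO (ends : E → Sym2 V) (a₁ a₂ b o : V) : Config E → Config E → R :=
  fun y w => foldBO ends a₁ a₂ b o y w * iL ends a₁ b w

/-- The CROSSING-class summand: the folded summand weighted by `(1 − 1_{b ∈ C₁}(w))·1_{b ∈ C₂}(w)`
(`b` red-attached to `a₁` and blue-attached to `a₂`: `b ∈ S ∩ T′`). -/
noncomputable def crossClassBO (ends : E → Sym2 V) (a₁ a₂ b o : V) : Config E → Config E → R :=
  fun y w => foldBO ends a₁ a₂ b o y w * (1 - iL ends a₁ b w) * iH ends a₂ b w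

/-- The FREE-class summand: the folded summand weighted by `(1 − 1_{b ∈ C₁}(w))·(1 − 1_{b ∈ C₂}(w))`
(`b` in no cluster of the second copy's roots: `b ∈ S ∖ (S′ ∪ T′)`). -/
noncomputable def freeClassBO (ends : E → Sym2 V) (a₁ a₂ b o : V) : Config E → Config E → R :=
  fun y w => foldBO ends a₁ a₂ b o y w * (1 - iL ends a₁ b w) * (1 - iH ends a₂ b w)

omit [Fintype E] [DecidableEq E] in
/-- Pointwise: the folded summand is the sum of its three class summands (`a + (1 − a)(c + (1 − c)) = 1`). -/
lemma foldBO_eq_classes (ends : E → Sym2 V) (a₁ a₂ b o : V) :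
    (foldBO ends a₁ a₂ b o : Config E → Config E → R) =
      fun y w => coreBO ends a₁ a₂ b o y w + crossClassBO ends a₁ a₂ b o y w +
        freeClassBO ends a₁ a₂ b o y w := by
  funext y w
  simp only [coreBO, crossClassBO, freeClassBO]
  ring

omit [Fintype E] [DecidableEq E] in
/-- The core-class summand is ANTISYMMETRIC under the exchange of the two copies. -/
lemma coreBO_swap (ends : E → Sym2 V) (a₁ a₂ b o : V) (y w : Config E) :
    (coreBO ends a₁ a₂ b o w y : R) = - coreBO ends a₁ a₂ b o y w := by
  simp only [coreBO, foldBO]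
  ring

/-- **The core class contributes nothing**: `pairCount F z coreBO = 0` (the summand changes sign when
the two copies are exchanged, and the exchange is a bijection of the admissible first copies). -/
theorem pairCount_core_eq_zero [CharZero R] (ends : E → Sym2 V) (a₁ a₂ b o : V) (F : Finset E)
    (z : Config E) :
    pairCount F z (coreBO ends a₁ a₂ b o : Config E → Config E → R) = 0 := by
  have h1 := pairCount_swap F z (coreBO ends a₁ a₂ b o : Config E → Config E → R)
  have h2 : (fun y w => (coreBO ends a₁ a₂ b o w y : R)) =
      fun y w => (-1 : R) * coreBO ends a₁ a₂ b o y w := by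
    funext y w; rw [coreBO_swap]; ring
  rw [h2, pairCount_const_mul] at h1
  have h3 : (2 : R) * pairCount F z (coreBO ends a₁ a₂ b o : Config E → Config E → R) = 0 := by
    linear_combination h1
  have h4 : (2 : R) ≠ 0 := two_ne_zero
  exact (mul_eq_zero.mp h3).resolve_left h4

/-- **The (TB14) slack is the sum of the crossing-class and free-class counts**:
`N(QAB, Q) − N(QB, QA) = pairCount F z crossClassBO + pairCount F z freeClassBO`. -/
theorem tb14_slack_eq_classes [CharZero R] (ends : E → Sym2 V) (a₁ a₂ b o : V) (F : Finset E)
    (z : Config E) :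
    pairCount F z (sameBO ends a₁ a₂ b o : Config E → Config E → R) -
      pairCount F z (crossBO ends a₁ a₂ b o) =
      pairCount F z (crossClassBO ends a₁ a₂ b o) + pairCount F z (freeClassBO ends a₁ a₂ b o) := by
  rw [pairCount_fold, foldBO_eq_classes]
  have h : pairCount F z (fun y w => coreBO ends a₁ a₂ b o y w + crossClassBO ends a₁ a₂ b o y w +
      freeClassBO ends a₁ a₂ b o y w : Config E → Config E → R) =
      pairCount F z (fun y w => coreBO ends a₁ a₂ b o y w + crossClassBO ends a₁ a₂ b o y w) +
        pairCount F z (freeClassBO ends a₁ a₂ b o) := pairCount_add F z _ _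
  rw [h, pairCount_add, pairCount_core_eq_zero, zero_add]

/-- (TB14) at a profile holds as soon as BOTH class counts are ≤ 0 (the two candidate class
inequalities of row 2′TB-X). -/
theorem tb14_of_classes [LinearOrder R] [IsStrictOrderedRing R] (ends : E → Sym2 V) (a₁ a₂ b o : V)
    (F : Finset E) (z : Config E)
    (hX : pairCount F z (crossClassBO ends a₁ a₂ b o : Config E → Config E → R) ≤ 0)
    (hD : pairCount F z (freeClassBO ends a₁ a₂ b o : Config E → Config E → R) ≤ 0) :
    pairCount F z (sameBO ends a₁ a₂ b o : Config E → Config E → R) ≤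
      pairCount F z (crossBO ends a₁ a₂ b o) := by
  have := tb14_slack_eq_classes ends a₁ a₂ b o F z (R := R)
  linarith

end Classes

end TB14Fold

end Summit.Ventures.PercRepro2
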